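import Literature.MathematicalPhysics.QuantumFieldTheory.OSMeanValueGeneric
import Literature.MathematicalPhysics.QuantumFieldTheory.OSSmearedSectorData
import HarnessLib

/-!
# The explicit pointwise bound of a Schwinger function at a point of the ordered region (OS II, Ch. VI.1)

Topic `Literature/MathematicalPhysics/QuantumFieldTheory`; support file (all proved; no new
definitions beyond a chosen continuation; no named facts): **the temperedness mechanism of
Osterwalder–Schrader II, Ch. VI.1 with every constant explicit and the exponent linear in the
number of points.** The abstract mean-value bound (`OSMeanValueGeneric`) is fed with the
continuation of the smeared skeleton produced by the `(1 + Σ w)^{-2M}`-damped sector engine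
(`OSSmearedSectorData.exists_smeared_extension`), transported to configuration space:

* `sectorRegion_mono` — monotonicity of the sector region in the opening;
* `smearGamma` — the chosen continuation `Γ_v(ζ) = Gt_v(tail(L(ζ − cfgPt pbase)))`;
* `norm_density_le_explicit` — for a local holomorphic density `S` of `𝔖_{k+2}` on
  `ball (cfgPt x) ρ` and skeleton data `(ξ, ê, g)` with positive tail coordinates at `x`:
  `‖S(cfgPt x)‖ ≤ π^{-N}(2√(2r₁))^N · max(C_real, C_slot) · (1 + Σⱼ (tailR U_x j + rt))^{2M}`.

## References

* K. Osterwalder, R. Schrader, *Axioms for Euclidean Green's functions II*, Comm. Math. Phys. 42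
  (1975) 281–305, Thm. 4.1 (4.5); Ch. VI.1 (6.4)–(6.16). [OsterwalderSchraderCMP1975]
-/

noncomputable section

open MeasureTheory Complex Set Metric Filter
open _root_.Topology
open scoped InnerProductSpace RealInnerProductSpace SchwartzMap NNReal Real

namespace Literature.MathematicalPhysics.QuantumFieldTheory

open Literature.MathematicalPhysics.QuantumLattice (SchwingerFamily IsPositiveTimeMulti schwartzNorm)
open Literature.MathematicalPhysics.QuantumLattice.SchwingerFamily
open Literature.MathematicalPhysics.QuantumLattice.SchwingerFamily.OSSpace
open Literature.Analysis.FunctionSpaces.SchwartzAverage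
open Literature.Analysis.Distribution
open Literature.Analysis.Complex
open OSFrames LogSlot OSEnvelope

variable {d : ℕ} [NeZero d]

omit [NeZero d] in
/-- The sector region grows with the opening. [folklore] -/
theorem sectorRegion_mono (K : ℕ) {c c' : ℝ} (h : c ≤ c') : sectorRegion K c ⊆ sectorRegion K c' :=
  fun _ hw => ⟨hw.1, lt_of_lt_of_le hw.2 h⟩

section AtPoint

variable (𝔖 : SchwingerFamily (EuclideanSpace ℝ (Fin d))) (hE1 : 𝔖.IsEuclideanCovariant)
  (hE2 : 𝔖.IsOSReflectionPositive) {k : ℕ}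
  (ξ : Fin (k + 1) → EuclideanSpace ℝ (Fin d)) (ê : Fin d → EuclideanSpace ℝ (Fin d)) (hli : LinearIndependent ℝ ê) {g r₀ : ℝ}
  (hê1 : ∀ μ, ‖ê μ‖ = 1) (hêê : ∀ μ ν, 0 ≤ ⟪ê μ, ê ν⟫) (hξ : ∀ μ i', g ≤ ⟪ê μ, ξ i'⟫)
  (hg : 2 * r₀ < g) (hr₀ : 0 ≤ r₀)
  {s : ℕ} {Cv : ℕ → ℝ} (hCv : ∀ n, 0 ≤ Cv n)
  (hv : ∀ (n : ℕ) (K : 𝓢((Fin n → EuclideanSpace ℝ (Fin d)), ℂ)) (hK : IsPositiveTimeMulti K),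
    ‖ι 𝔖 hE2 (δ 𝔖 hE2 (mkGen K hK))‖ ≤ Cv n * schwartzNorm ((n + n) * s) K)
  {M : ℕ} (hM : (k + 1 + (k + 1)) * s ≤ M)
  {s₀ : ℕ} {C₀ : ℝ} (hC₀ : 0 ≤ C₀)
  (hσ : ∀ F : 𝓢((Fin (k + 2) → EuclideanSpace ℝ (Fin d)), ℂ), ‖𝔖 (k + 2) F‖ ≤ C₀ * schwartzNorm s₀ F)
  (hs₀M : s₀ ≤ M)
  {r₁ : ℝ} (hr₁ : 0 < r₁) (hr₁1 : r₁ ≤ 1)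
  -- the local holomorphic density
  {x : Fin (k + 2) → EuclideanSpace ℝ (Fin d)} {ρ ρ₂ : ℝ} {S : (Fin (k + 2) → Fin d → ℂ) → ℂ}
  (hSd : DifferentiableOn ℂ S (ball (cfgPt x) ρ)) {Bs : ℝ} (hSB : ∀ ζ ∈ ball (cfgPt x) ρ, ‖S ζ‖ ≤ Bs)
  (hSrep : ∀ F : 𝓢((Fin (k + 2) → EuclideanSpace ℝ (Fin d)), ℂ),
    tsupport (F : (Fin (k + 2) → EuclideanSpace ℝ (Fin d)) → ℂ) ⊆ Metric.ball x ρ → 𝔖 (k + 2) F = ∫ y, S (cfgPt y) * F y)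
  (hρ₂ : 0 < ρ₂)
  (hr₀eq : ‖(frameMap ê hli : EuclideanSpace ℝ (Fin d) →L[ℝ] EuclideanSpace ℝ (Fin d))‖ * Real.sqrt (2 * d * r₁) ≤ r₀)
  (hρρ : ρ₂ + r₀ < ρ)
  {rt : ℝ} (hrt : ∀ j, rt ≤ tailR ((posLinCLE (k := k) ê hli).symm (x - pbase ξ)) j * Real.sin (π / (4 * (slotK k d + 1))))
  (hLρ : max ‖((posLinCLE (k := k) ê hli).symm.toContinuousLinearMap)‖
      (cplxLBound ((posLinCLE (k := k) ê hli).symm.toContinuousLinearMap)) * ρ₂ < rt)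
  (hfit : ((k + 2) * d : ℝ) * (2 * Real.sqrt (2 * r₁)) < ρ₂)
  (hfit2 : ‖(frameMap ê hli : EuclideanSpace ℝ (Fin d) →L[ℝ] EuclideanSpace ℝ (Fin d))‖ * Real.sqrt d * Real.sqrt (2 * r₁) < ρ₂)

/-- The geometric constants `(a₁, Rφ, B₁)` of the frame profiles. [folklore] -/
def fpA (ê : Fin d → EuclideanSpace ℝ (Fin d)) (hli : LinearIndependent ℝ ê) (M : ℕ) (r₁ : ℝ) : ℝ :=
  frameJac ê hli * (2 * (((M : ℝ) + 1) / r₁)) ^ d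
/-- The geometric constants `(a₁, Rφ, B₁)` of the frame profiles. [folklore] -/
def fpR (ê : Fin d → EuclideanSpace ℝ (Fin d)) (hli : LinearIndependent ℝ ê) : ℝ :=
  max 1 (‖(frameMap ê hli : EuclideanSpace ℝ (Fin d) →L[ℝ] EuclideanSpace ℝ (Fin d))‖ * (2 * Real.sqrt d))
/-- The geometric constants `(a₁, Rφ, B₁)` of the frame profiles. [folklore] -/
def fpB (ê : Fin d → EuclideanSpace ℝ (Fin d)) (hli : LinearIndependent ℝ ê) (M : ℕ) (r₁ : ℝ) : ℝ :=
  ‖((frameMap ê hli).symm : EuclideanSpace ℝ (Fin d) →L[ℝ] EuclideanSpace ℝ (Fin d))‖ *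
    ((d : ℝ) * (6 * ((M : ℝ) + 1) * max 1 (((M : ℝ) + 1) / r₁ * baseDerivL1)))

omit [NeZero d] in
/-- `1 ≤ fpR`. [folklore] -/
theorem one_le_fpR : 1 ≤ fpR ê hli := le_max_left _ _

omit [NeZero d] in
/-- `0 ≤ fpB`. [folklore] -/
theorem fpB_nonneg (M : ℕ) (r₁ : ℝ) : 0 ≤ fpB ê hli M r₁ := by
  unfold fpB; have := baseDerivL1_nonneg; positivity

omit [NeZero d] in
/-- `0 ≤ fpA` for `r₁ > 0`. [folklore] -/
theorem fpA_nonneg (M : ℕ) {r₁ : ℝ} (hr₁ : 0 < r₁) : 0 ≤ fpA ê hli M r₁ := by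
  unfold fpA; have := frameJac_nonneg ê hli; positivity

/-- **The explicit constant** `max(C_real, C_slot)` of the smeared-skeleton engine at the frame profiles. [folklore] -/
def smearCmax (k M s₀ : ℕ) (C₀ : ℝ) (ξ : Fin (k + 1) → EuclideanSpace ℝ (Fin d)) (ê : Fin d → EuclideanSpace ℝ (Fin d))
    (hli : LinearIndependent ℝ ê) (g : ℝ) (Cv : ℕ → ℝ) (r₁ : ℝ) : ℝ :=
  max (smearRealC k s₀ C₀ (skelPosConst ξ ê) (fpA ê hli M r₁) (fpR ê hli) (fpB ê hli M r₁))
    (smearSlotC k M (fpA ê hli M r₁) (fpR ê hli) (fpB ê hli M r₁) (unitSlotC ξ ê g Cv M))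

include hE1 hê1 hêê hξ hg hr₀ hCv hv hM hC₀ hσ hs₀M hr₁1 hr₀eq in
/-- The continuations of the smeared skeletons of the frame profiles (a choice, for every `v`). [folklore] -/
theorem exists_frameGt (vb : Fin (k + 2) → Fin d → ℝ) :
    ∃ Gt : (Fin (slotK k d + 1) → ℂ) → ℂ, DifferentiableOn ℂ Gt (sectorRegion (slotK k d) (π / 2)) ∧
      (∀ u : Fin (slotK k d + 1) → ℝ, (∀ j, 0 < u j) → Gt (fun j => (u j : ℂ)) = skelSVr 𝔖 (frameProfs ê hli M hr₁ vb) ξ ê u) ∧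
      ∀ w ∈ sectorRegion (slotK k d) (π / 4),
        ‖Gt w‖ ≤ smearCmax k M s₀ C₀ ξ ê hli g Cv r₁ * (1 + ∑ j, ‖w j‖) ^ (M + M) :=
  exists_smeared_extension 𝔖 hE1 hE2 (frameProfs ê hli M hr₁ vb) ξ ê (tsupport_frameProfs_subset ê hli M hr₁ hr₀eq vb)
    hê1 hêê hξ hg hr₀ hCv hv hM hC₀ hσ (one_le_fpR ê hli) (fpB_nonneg ê hli M r₁) (fpA_nonneg ê hli M hr₁)
    (frameProfs_geometric ê hli M hr₁ hr₁1 vb) hs₀M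

include hE1 hê1 hêê hξ hg hr₀ hCv hv hM hC₀ hσ hs₀M hr₁ hr₁1 hSd hSB hSrep hρ₂ hr₀eq hρρ hrt hLρ hfit hfit2 in
/-- **The explicit pointwise bound** (OS II Ch. VI.1, (6.4)–(6.16), with the polynomial-weight
maximum principle (6.13)–(6.15)):
`‖S(cfgPt x)‖ ≤ π^{-N}(2√(2r₁))^N · max(C_real, C_slot) · (1 + Σⱼ (tailR U_x j + rt))^{2M}`. [cite: OsterwalderSchraderCMP1975, Thm. 4.1 (4.5); Ch. VI.1 (6.4)–(6.16)] -/
theorem norm_density_le_explicit :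
    ‖S (cfgPt x)‖ ≤ (π ^ ((k + 2) * d))⁻¹ * (2 * Real.sqrt (2 * r₁)) ^ ((k + 2) * d) *
      (smearCmax k M s₀ C₀ ξ ê hli g Cv r₁ *
        (1 + ∑ j, (tailR ((posLinCLE (k := k) ê hli).symm (x - pbase ξ)) j + rt)) ^ (M + M)) := by
  classical
  set L := (posLinCLE (k := k) ê hli).symm.toContinuousLinearMap with hL
  set U₀ := (posLinCLE (k := k) ê hli).symm (x - pbase ξ) with hU₀
  have hrt0 : 0 < rt := rt_pos ê hli hρ₂ hLρ
  -- the chosen continuations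
  choose Gt hGtd hGtreal hGtB using exists_frameGt 𝔖 hE1 hE2 ξ ê hli hê1 hêê hξ hg hr₀ hCv hv hM hC₀ hσ hs₀M hr₁ hr₁1 hr₀eq
  set Γ : (Fin (k + 2) → Fin d → ℝ) → (Fin (k + 2) → Fin d → ℂ) → ℂ := fun vb ζ => Gt vb (tailC (cplxL L (ζ - cfgPt (pbase ξ)))) with hΓ
  -- geometry of the transport
  have hcentre : cplxL L (cfgPt x - cfgPt (pbase ξ)) = eRealPt U₀ := by rw [← cfgPt_sub, cplxL_cfgPt]; rfl
  have hρA : cplxLBound L * ρ₂ < rt := lt_of_le_of_lt (mul_le_mul_of_nonneg_right (le_max_right _ _) hρ₂.le) hLρ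
  have hmapB : ∀ ζ ∈ ball (cfgPt x) ρ₂, cplxL L (ζ - cfgPt (pbase ξ)) ∈ ball (eRealPt U₀) rt := fun ζ hζ => by
    rw [← hcentre]; exact cplxL_mem_ball L hζ hρA _
  have htail : ∀ ζ ∈ ball (cfgPt x) ρ₂, tailC (cplxL L (ζ - cfgPt (pbase ξ))) ∈ ball (fun j => ((tailR U₀ j : ℝ) : ℂ)) rt := fun ζ hζ => by
    rw [← tailC_eRealPt]; exact tailC_mem_ball (hmapB ζ hζ)
  have hsec : ∀ ζ ∈ ball (cfgPt x) ρ₂, tailC (cplxL L (ζ - cfgPt (pbase ξ))) ∈ sectorRegion (slotK k d) (π / 4) := fun ζ hζ =>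
    ball_subset_sectorRegion hrt (htail ζ hζ)
  -- the three properties of `Γ`
  have hmap : Differentiable ℂ (fun ζ : Fin (k + 2) → Fin d → ℂ => tailC (cplxL L (ζ - cfgPt (pbase ξ)))) :=
    (differentiable_tailC (k := k) (d := d)).comp (differentiable_cplxL L (cfgPt (pbase ξ)))
  have hΓd : ∀ vb, DifferentiableOn ℂ (Γ vb) (ball (cfgPt x) ρ₂) := fun vb =>
    (hGtd vb).comp hmap.differentiableOn fun ζ hζ => sectorRegion_mono _ (by linarith [Real.pi_pos]) (hsec ζ hζ)
  have hΓreal : ∀ vb (X : Fin (k + 2) → EuclideanSpace ℝ (Fin d)), ‖X - x‖ < ρ₂ →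
      Γ vb (cfgPt X) = 𝔖 (k + 2) (skeletonFnV (SchwartzMap.tensorFin (k + 2) (frameProfs ê hli M hr₁ vb)) X) := by
    intro vb X hX
    set UX := (posLinCLE (k := k) ê hli).symm (X - pbase ξ) with hUX
    have hpos : ∀ j, 0 < tailR UX j := tailR_pos_of_near ξ ê hli hρ₂ hrt hLρ hX
    have hXU : posAff ξ ê hli UX = X := by
      rw [posAff, hUX, ContinuousLinearEquiv.apply_symm_apply, add_sub_cancel]
    have h1 : posAff ξ ê hli UX = fun j => posV ξ ê (tailBlocks UX) j + dirMap ê hli (fun μ => UX (0, μ)) :=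
      funext fun j => posAff_eq_posV ξ ê hli UX j
    simp only [hΓ]
    rw [← cfgPt_sub, cplxL_cfgPt, show L (X - pbase ξ) = UX from rfl, tailC_eRealPt, hGtreal vb _ hpos, skelSVr, reindexV_tailR]
    conv_rhs => rw [← hXU, h1, ← schwinger_skeletonFnV_add_const hE1]
    rfl
  have hΓB : ∀ vb, ∀ ζ ∈ ball (cfgPt x) ρ₂, ‖Γ vb ζ‖ ≤ smearCmax k M s₀ C₀ ξ ê hli g Cv r₁ *
      (1 + ∑ j, (tailR U₀ j + rt)) ^ (M + M) := by
    intro vb ζ hζ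
    refine (hGtB vb _ (hsec ζ hζ)).trans (mul_le_mul_of_nonneg_left ?_ ?_)
    · refine pow_le_pow_left₀ (by positivity) (add_le_add le_rfl (Finset.sum_le_sum fun j _ => ?_)) _
      have hj := htail ζ hζ
      rw [mem_ball, dist_eq_norm] at hj
      have h1 : ‖(tailC (cplxL L (ζ - cfgPt (pbase ξ))) - fun j => ((tailR U₀ j : ℝ) : ℂ)) j‖ < rt :=
        lt_of_le_of_lt (norm_le_pi_norm _ j) hj
      rw [Pi.sub_apply] at h1
      calc ‖tailC (cplxL L (ζ - cfgPt (pbase ξ))) j‖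
          = ‖(tailC (cplxL L (ζ - cfgPt (pbase ξ))) j - ((tailR U₀ j : ℝ) : ℂ)) + ((tailR U₀ j : ℝ) : ℂ)‖ := by rw [sub_add_cancel]
        _ ≤ ‖tailC (cplxL L (ζ - cfgPt (pbase ξ))) j - ((tailR U₀ j : ℝ) : ℂ)‖ + ‖((tailR U₀ j : ℝ) : ℂ)‖ := norm_add_le _ _
        _ ≤ rt + tailR U₀ j := by
            rw [Complex.norm_real, Real.norm_eq_abs, abs_of_pos (tailR_centre_pos hrt0 hrt j).1]
            exact add_le_add h1.le le_rfl
        _ = tailR U₀ j + rt := add_comm _ _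
    · have h0 : 0 ≤ smearCmax k M s₀ C₀ ξ ê hli g Cv r₁ * (1 + ∑ j, ‖tailC (cplxL L (ζ - cfgPt (pbase ξ))) j‖) ^ (M + M) :=
        (norm_nonneg _).trans (hGtB vb _ (hsec ζ hζ))
      have h1 : 0 < (1 + ∑ j, ‖tailC (cplxL L (ζ - cfgPt (pbase ξ))) j‖) ^ (M + M) := by positivity
      exact (mul_nonneg_iff_of_pos_right h1).1 h0
  exact norm_density_le_meanValue_generic 𝔖 ê hli hê1 hr₁ hSd hSB hSrep hρ₂ hr₀eq hρρ Γ hΓd hΓreal hΓB hfit hfit2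

end AtPoint

end Literature.MathematicalPhysics.QuantumFieldTheory
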